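import Literature.MathematicalPhysics.QuantumLattice.SymmetryProjectedVariationalBound
import Literature.MathematicalPhysics.QuantumLattice.HubbardNNNHoppingWindowCertificateD4
import HarnessLib

/-!
# The symmetry-projected (PHF) variational bound for the `t–t'` Hubbard torus

Topic `Literature/MathematicalPhysics/QuantumLattice`. Companion of `SymmetryProjectedVariationalBound.lean`
(§4–§6: the bound for the nearest-neighbour torus Hamiltonian `hubbardTorus 2 L t U`) for the `t–t'` Hamiltonian
`hubbardTorusTT' L t t' U = hamiltonian (fermionTorusGraph 2 L) t U + hamiltonian (fermionTorusDiagGraph L) t' 0`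
(`HubbardNNNHopping.lean`; Xu et al. (2024) eq. (1), LeBlanc et al. (2015) eq. (1)).  The space group
`squareSpaceGroup L` (translations and the site point group `D₄`) acts by automorphisms of BOTH bond graphs of
`(ℤ/Lℤ)²` — nearest-neighbour (`squareSpaceGroup_le_autPerm`) and diagonal (`squareSpaceGroup_le_autPerm_diag`,
from the tree's `fermionTorusDiagGraph_adj_d4SitePerm` and the translation computation of
`relabel_translate_hubbardTorusTT'`) — so the orbital-permutation unitaries and the singlet projector commute with
`hubbardTorusTT'`, and the abstract projected variational principle `groundEnergy_le_re_expect_proj_div`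
(Rodríguez-Guzmán et al. (2012) eq. (8)) gives, for every unitary character `χ` of the space group and every
`N`-particle trial vector `Φ` with positive norm kernel,
`E₀(H^{tt'}_{(ℤ/Lℤ)²}; N) ≤ Re ⟨Φ, H^{tt'} P_{S=0} P_χ Φ⟩ / Re ⟨Φ, P_{S=0} P_χ Φ⟩`
(`hubbardTorusTT'_groundEnergy_le_singlet_projected_div`).  This is the soundness shape of a `t' ≠ 0`
symmetry-projected Slater-determinant (SPHF) energy certificate on the torus.  Everything is PROVED; no definition,
no named fact.

References: R. Rodríguez-Guzmán, K. W. Schmid, C. A. Jiménez-Hoyos, G. E. Scuseria, PRB 85 (2012) 245130, §II eqs. (5)–(8);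
H. Shi, C. A. Jiménez-Hoyos, R. Rodríguez-Guzmán, G. E. Scuseria, S. Zhang, PRB 89 (2014) 125129, §II.A;
H. Xu et al., Science 384 (2024) eadh7691, eq. (1).
-/

noncomputable section

namespace Literature.MathematicalPhysics.QuantumLattice

namespace SymmetryProjection

open Matrix HubbardWave0 Literature.Probability.LatticeModels
open scoped ComplexOrder BigOperators ComplexConjugate

section TwoGraph

variable {Λ : Type*} [LinearOrder Λ] [Fintype Λ] {G : Type*} [Group G] [Fintype G]

/-- `P_χ` maps the `N`-particle sector to itself when every `U_g` does (the tree's private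
`isNParticle_charProj_mulVec`, re-proved). [folklore] -/
private theorem isNParticle_charProj_mulVec' {ι : Type*} [LinearOrder ι] [Fintype ι]
    (ρ : G →* Matrix.unitaryGroup (Finset ι) ℂ) (χ : G →* Circle) {N : ℕ}
    (hρ : ∀ (g : G) (ψ : Fock ι), IsNParticle N ψ → IsNParticle N ((ρ g).val *ᵥ ψ))
    {φ : Fock ι} (hφ : IsNParticle N φ) : IsNParticle N (charProj ρ χ *ᵥ φ) := by
  rw [← mem_nParticleSubmodule_iff]
  unfold charProj
  rw [smul_mulVec, sum_mulVec]
  refine Submodule.smul_mem _ _ (Submodule.sum_mem _ fun g _ => ?_)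
  rw [smul_mulVec]
  exact Submodule.smul_mem _ _ ((mem_nParticleSubmodule_iff _ _).2 (hρ g φ hφ))

/-- **The symmetry-projected variational bound for a two-graph Hubbard Hamiltonian**
`H = hamiltonian G₁ t U + hamiltonian G₂ t' U'` (e.g. nearest-neighbour + diagonal hopping): for a finite group
acting on the sites by automorphisms of BOTH graphs, a unitary character `χ`, a Hermitian idempotent `Q` commuting
with `H` and with the lattice unitaries and preserving the `N`-particle sector, and any `N`-particle `Φ` with
positive norm kernel, `E₀(H; N) ≤ Re ⟨Φ, H Q P_χ Φ⟩ / Re ⟨Φ, Q P_χ Φ⟩`.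
[cite: RodriguezGuzmanEtAl2012, §II eqs. (5)–(8)] [cite: ShiEtAl2014, §II.A] -/
theorem twoGraph_groundEnergy_le_projected_div (G₁ G₂ : SimpleGraph Λ) [DecidableRel G₁.Adj] [DecidableRel G₂.Adj]
    (π : G →* Equiv.Perm Λ) (h₁ : ∀ g x y, G₁.Adj (π g x) (π g y) ↔ G₁.Adj x y)
    (h₂ : ∀ g x y, G₂.Adj (π g x) (π g y) ↔ G₂.Adj x y) (t U t' U' : ℝ) (χ : G →* Circle)
    {Q : Matrix (Finset (Orb Λ)) (Finset (Orb Λ)) ℂ} (hQ : Qᴴ = Q) (hQQ : Q * Q = Q)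
    (hQH : Commute Q (hamiltonian G₁ t U + hamiltonian G₂ t' U')) (hQρ : ∀ g, Commute (latticeRep π g).val Q)
    {N : ℕ} (hQN : ∀ ψ : Fock (Orb Λ), IsNParticle N ψ → IsNParticle N (Q *ᵥ ψ))
    {φ : Fock (Orb Λ)} (hφ : IsNParticle N φ)
    (hpos : 0 < (expect (Q * charProj (latticeRep π) χ) φ).re) :
    groundEnergy (hamiltonian G₁ t U + hamiltonian G₂ t' U') N ≤
      (expect ((hamiltonian G₁ t U + hamiltonian G₂ t' U') * (Q * charProj (latticeRep π) χ)) φ).re /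
        (expect (Q * charProj (latticeRep π) χ) φ).re := by
  have hcomm : Commute Q (charProj (latticeRep π) χ) := (charProj_commute _ _ hQρ).symm
  have hP : (Q * charProj (latticeRep π) χ)ᴴ = Q * charProj (latticeRep π) χ := by
    rw [conjTranspose_mul, hQ, charProj_conjTranspose, hcomm.eq]
  have hPP : Q * charProj (latticeRep π) χ * (Q * charProj (latticeRep π) χ) = Q * charProj (latticeRep π) χ := by
    rw [Matrix.mul_assoc, ← Matrix.mul_assoc (charProj (latticeRep π) χ) Q, ← hcomm.eq, Matrix.mul_assoc,
      charProj_mul_self, ← Matrix.mul_assoc, hQQ]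
  have hρH : ∀ g, Commute (latticeRep π g).val (hamiltonian G₁ t U + hamiltonian G₂ t' U') := fun g =>
    (latticeRep_commute_hamiltonian G₁ π h₁ t U g).add_right (latticeRep_commute_hamiltonian G₂ π h₂ t' U' g)
  have hPH : Commute (Q * charProj (latticeRep π) χ) (hamiltonian G₁ t U + hamiltonian G₂ t' U') :=
    hQH.mul_left (charProj_commute _ _ hρH)
  have hPφ : IsNParticle N ((Q * charProj (latticeRep π) χ) *ᵥ φ) := by
    rw [← mulVec_mulVec]
    exact hQN _ (isNParticle_charProj_mulVec' _ _ (fun g ψ hψ => isNParticle_latticeRep_mulVec π g hψ) hφ)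
  exact groundEnergy_le_re_expect_proj_div _ hP hPP hPH hPφ hpos

end TwoGraph

section SquareTorusTTPrime

variable {L : ℕ} [NeZero L]

/-- (Local DecidableEq pin, as in `SymmetryProjectedVariationalBound` §4–§6.) [folklore] -/
local instance (priority := high) instDecidableEqFermionTorusSymmetryProjectionTTPrime :
    DecidableEq (FermionTorus 2 L) :=
  LinearOrder.toDecidableEq

/-- Translations of `(ℤ/Lℤ)²` are automorphisms of the DIAGONAL (next-nearest-neighbour) bond graph
(`y = x ± (e₁ ± e₂)` is translation invariant; the computation of the tree's `relabel_translate_hubbardTorusTT'`).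
[cite: XuEtAl2024, eq. (1)] -/
theorem ofTorusPerm_addRight_mem_autPerm_diag (v : TorusSite 2 L) :
    FermionTorus.ofTorusPerm (Equiv.addRight v) ∈ autPerm (fermionTorusDiagGraph L) := by
  intro x y
  show (fermionTorusDiagGraph L).Adj (FermionTorus.ofTorusEquiv (Equiv.addRight v) x)
      (FermionTorus.ofTorusEquiv (Equiv.addRight v) y) ↔ (fermionTorusDiagGraph L).Adj x y
  rw [fermionTorusDiagGraph_adj, fermionTorusDiagGraph_adj, FermionTorus.toTorusSite_ofTorusEquiv,
    FermionTorus.toTorusSite_ofTorusEquiv, torusDiagGraph_adj_iff, torusDiagGraph_adj_iff, Equiv.coe_addRight]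
  refine and_congr (not_congr (add_left_inj v)) (or_congr (exists_congr fun s => ?_) (exists_congr fun s => ?_))
  · rw [add_right_comm, add_left_inj]
  · rw [add_right_comm, add_left_inj]

/-- The site point group `D₄` acts by automorphisms of the diagonal bond graph (tree
`fermionTorusDiagGraph_adj_d4SitePerm`). [cite: ShiEtAl2014, §II.A] -/
theorem ofTorusPerm_d4SitePerm_mem_autPerm_diag (γ : DihedralGroup 4) :
    FermionTorus.ofTorusPerm (d4SitePerm γ) ∈ autPerm (fermionTorusDiagGraph L) :=
  fun x y => fermionTorusDiagGraph_adj_d4SitePerm γ x y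

/-- **The space group of the square torus consists of automorphisms of the diagonal bond graph** (so of the
whole `t–t'` bond structure, with `squareSpaceGroup_le_autPerm`). [cite: ShiEtAl2014, §II.A] [cite: XuEtAl2024, eq. (1)] -/
theorem squareSpaceGroup_le_autPerm_diag : squareSpaceGroup L ≤ autPerm (fermionTorusDiagGraph L) := by
  refine (Subgroup.closure_le _).2 ?_
  rintro f (⟨v, rfl⟩ | ⟨γ, rfl⟩)
  exacts [ofTorusPerm_addRight_mem_autPerm_diag v, ofTorusPerm_d4SitePerm_mem_autPerm_diag γ]

/-- **The spin- and space-group-projected (PHF) variational bound for the `t–t'` Hubbard torus `(ℤ/Lℤ)²`**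
— Rodríguez-Guzmán et al. eq. (8) for `Θ = (S = 0; k, parities)` and the Hamiltonian `hubbardTorusTT' L t t' U`
(nearest-neighbour hopping `t`, diagonal hopping `t'`, on-site `U`): for every unitary character `χ` of
`squareSpaceGroup L` and every `N`-particle trial vector `Φ` with positive norm kernel,
`E₀(H^{tt'}; N) ≤ Re ⟨Φ, H^{tt'} P_{S=0} P_χ Φ⟩ / Re ⟨Φ, P_{S=0} P_χ Φ⟩`.  At `t' = 0` this is the tree's
`rectTorus_groundEnergyAt_le_singlet_projected_div` (via `hubbardTorusTT'_zero`, `groundEnergyAt_fermionTorusGraph_two`).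
What a certificate quoting this theorem must still supply is the exact arithmetic of the two kernels.
[cite: RodriguezGuzmanEtAl2012, §II eqs. (5)–(8)] [cite: ShiEtAl2014, §II.A] [cite: XuEtAl2024, eq. (1)] -/
theorem hubbardTorusTT'_groundEnergy_le_singlet_projected_div (t t' U : ℝ) (χ : squareSpaceGroup L →* Circle)
    {N : ℕ} {φ : Fock (Orb (FermionTorus 2 L))} (hφ : IsNParticle N φ)
    (hpos : 0 < (expect (singletProj * charProj (latticeRep (squareSpaceGroup L).subtype) χ) φ).re) :
    groundEnergy (hubbardTorusTT' L t t' U) N ≤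
      (expect (hubbardTorusTT' L t t' U * (singletProj * charProj (latticeRep (squareSpaceGroup L).subtype) χ)) φ).re /
        (expect (singletProj * charProj (latticeRep (squareSpaceGroup L).subtype) χ) φ).re := by
  have h₁ : ∀ (g : squareSpaceGroup L) x y, (fermionTorusGraph 2 L).Adj ((squareSpaceGroup L).subtype g x)
      ((squareSpaceGroup L).subtype g y) ↔ (fermionTorusGraph 2 L).Adj x y :=
    fun g x y => squareSpaceGroup_le_autPerm g.2 x y
  have h₂ : ∀ (g : squareSpaceGroup L) x y, (fermionTorusDiagGraph L).Adj ((squareSpaceGroup L).subtype g x)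
      ((squareSpaceGroup L).subtype g y) ↔ (fermionTorusDiagGraph L).Adj x y :=
    fun g x y => squareSpaceGroup_le_autPerm_diag g.2 x y
  have hQH : Commute (singletProj : Matrix (Finset (Orb (FermionTorus 2 L))) _ ℂ) (hubbardTorusTT' L t t' U) :=
    (singletProj_commute_hamiltonian (fermionTorusGraph 2 L) t U).add_right
      (singletProj_commute_hamiltonian (fermionTorusDiagGraph L) t' 0)
  exact twoGraph_groundEnergy_le_projected_div (fermionTorusGraph 2 L) (fermionTorusDiagGraph L)
    (squareSpaceGroup L).subtype h₁ h₂ t U t' 0 χ singletProj_conjTranspose singletProj_mul_self hQH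
    (fun g => fockRelabel_mapEquiv_commute_singletProj g.1) (fun _ h => isNParticle_singletProj_mulVec h) hφ hpos

end SquareTorusTTPrime

end SymmetryProjection

end Literature.MathematicalPhysics.QuantumLattice

end
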